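import Mathlib
import Summits.CriticalPhenomena.CardyFormulaZ2.Theorems.CardyMagicRigidityNestingRigidityUVLinearisation
import Summits.CriticalPhenomena.CardyFormulaZ2.Theorems.CardyMagicRigidityNestingRigidityTowerCountMeasurable
import Summits.CriticalPhenomena.CardyFormulaZ2.Theorems.CardyMagicRigidityNestingRigidityStaircaseReduction
import HarnessLib

/-!
# Crux `NestingRigidity`: the UNTILTED route to `UVDecoupling` — Hölder toolkit (part 1 of 2)

Crux `Summit.CriticalPhenomena.CardyFormulaZ2.Theses.CardyMagicRigidity.NestingRigidity`
(stmt-CriticalPhenomena-4835), lines `positive-cone-weight-doubling` (skeleton r3, seat c4-0) and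
`ring-cloud-tomography` (r6), shared stub R1' `stub_uvDecoupling : ∀ E ∈ latticeEnsembles, UVDecoupling E`.
Registered helper [C] `uvDecoupling_of_untilted_bounds` (part 2, `…HoelderReduction`): on both lattice
ensembles `UVDecoupling E` follows from
* [A] UNTILTED exponential moments of all orders of the centred additive UV statistic
  `Θ + t·E_δ N` (`E_δ Θ = −t E_δ N` exactly, `integral_uvPhase_latticeEnsembles`) and of `Θ₂ = Σ θ_u²`,
* [B] a-priori two-sided POWER bounds `r^{C} ≤ E_δ[v^{N_0(r,1)}] ≤ r^{-C}` on the tower moments,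
with NO tilted RSW statement.  Write `w = magicWeight t`, `N = N_0(r,1)`, `M(v) = E_δ[v^N]`,
`p = 1 + ε`.  By the landed pathwise sandwich `w^N e^{−√3Θ − Θ₂/cos(|t|+π/3)} ≤ A ≤ w^N e^{−√3Θ}`
(`UVLinear.finprod_nestingFactor_mem_Icc`):
* UPPER: `E[w^N e^{X}] ≤ M(w^p)^{1/p} E[e^{qX}]^{1/q}` (Hölder) and
  `M(w^p) ≤ M(w)^{1−ε} M(w²)^{ε}` (Hölder between the bases), so with `M(w) ≥ r^C`, `M(w²) ≤ r^{−C}`: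
  `M(w^p)^{1/p} ≤ r^{−3Cε} M(w)` (§1 `rpow_interp_upper`);
* LOWER: `M(w^{1/p}) ≤ E[w^N e^{Y}]^{1/p} E[e^{−Y/ε}]^{1/q}` (reverse Hölder) and
  `M(w) ≤ M(w^{1/p})^{(1+ε)/(1+2ε)} M(w²)^{ε/(1+2ε)}`, so `M(w^{1/p})^{p} ≥ r^{3Cε} M(w)`
  (§1 `rpow_interp_lower`);
choosing `3Cε ≤ η/2` and `r` small absorbs every constant into `r^{±η}`.  THIS FILE (part 1) is the
toolkit: §1 the two real-variable interpolation inequalities, §2 Hölder for non-negative functions given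
integrability of the powers (`holder_of_integrable_rpow`) and the registered anchor `towerMoment_interp` — INTERPOLATION OF TOWER MOMENTS IN THE BASE,
`E_δ[(v₁^θ v₂^{1−θ})^N] ≤ E_δ[v₁^N]^θ E_δ[v₂^N]^{1−θ}` (log-convexity of the pressure), both lattices.
Part 2 (`…HoelderReduction`) is the reduction itself.  No cited fact, no definition.
-/

noncomputable section

open MeasureTheory Set Filter Metric
open scoped Real Topology BigOperators ENNReal

namespace Summit.CriticalPhenomena.CardyFormulaZ2.Cruxes.NestingRigidity.PositiveConeWeightDoubling

open Literature.Probability.RandomPlanarGeometry Literature.Probability.Percolation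
  Literature.Probability.LatticeModels
open Summit.CriticalPhenomena.CardyFormulaZ2.Cruxes.NestingRigidity.RingCloudTomography

namespace Hoelder

/-! ## §1 Two real-variable interpolation inequalities (logarithmic convexity bookkeeping) -/

/-- UPPER interpolation: if `r^C ≤ M₁`, `M₂ ≤ r^{-C}` and `M_p ≤ M₁^{1−ε} M₂^{ε}` then
`M_p^{1/(1+ε)} ≤ r^{−3Cε} M₁` (`0 < r < 1`, `C ≥ 0`, `ε > 0`). -/
theorem rpow_interp_upper {M₁ M₂ Mp r C ε : ℝ} (hr : 0 < r) (hr1 : r < 1) (hC : 0 ≤ C) (hε : 0 < ε)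
    (hM₁ : 0 < M₁) (hM₂ : 0 < M₂) (hMp : 0 < Mp) (hlow : r ^ C ≤ M₁) (hup : M₂ ≤ r ^ (-C))
    (hH : Mp ≤ M₁ ^ (1 - ε) * M₂ ^ ε) : Mp ^ (1 / (1 + ε)) ≤ r ^ (-(3 * C * ε)) * M₁ := by
  have hℓ : Real.log r < 0 := Real.log_neg hr hr1
  have h1 : C * Real.log r ≤ Real.log M₁ := by
    rw [← Real.log_rpow hr]; exact Real.log_le_log (Real.rpow_pos_of_pos hr _) hlow
  have h2 : Real.log M₂ ≤ -C * Real.log r := by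
    have := Real.log_le_log hM₂ hup; rwa [Real.log_rpow hr] at this
  have h3 : Real.log Mp ≤ (1 - ε) * Real.log M₁ + ε * Real.log M₂ := by
    have := Real.log_le_log hMp hH
    rwa [Real.log_mul (Real.rpow_pos_of_pos hM₁ _).ne' (Real.rpow_pos_of_pos hM₂ _).ne',
      Real.log_rpow hM₁, Real.log_rpow hM₂] at this
  rw [Real.rpow_def_of_pos hMp, Real.rpow_def_of_pos hr, ← Real.exp_log hM₁, ← Real.exp_add,
    Real.exp_le_exp]
  have hε1 : 0 < 1 + ε := by linarith
  rw [mul_one_div, div_le_iff₀ hε1]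
  have e1 : 0 ≤ ε * (Real.log M₁ - C * Real.log r) := mul_nonneg hε.le (sub_nonneg.2 h1)
  have e2 : 0 ≤ C * ε ^ 2 * (-Real.log r) := mul_nonneg (by positivity) (by linarith)
  have e3 : ε * Real.log M₂ ≤ ε * (-C * Real.log r) := mul_le_mul_of_nonneg_left h2 hε.le
  nlinarith [e1, e2, e3, h3]

/-- LOWER interpolation: if `r^C ≤ M₁`, `M₂ ≤ r^{-C}` and
`M₁ ≤ M_q^{(1+ε)/(1+2ε)} M₂^{ε/(1+2ε)}` then `r^{3Cε} M₁ ≤ M_q^{1+ε}`. -/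
theorem rpow_interp_lower {M₁ M₂ Mq r C ε : ℝ} (hr : 0 < r) (hε : 0 < ε)
    (hM₁ : 0 < M₁) (hM₂ : 0 < M₂) (hMq : 0 < Mq) (hlow : r ^ C ≤ M₁) (hup : M₂ ≤ r ^ (-C))
    (hH : M₁ ≤ Mq ^ ((1 + ε) / (1 + 2 * ε)) * M₂ ^ (ε / (1 + 2 * ε))) :
    r ^ (3 * C * ε) * M₁ ≤ Mq ^ (1 + ε) := by
  have h1 : C * Real.log r ≤ Real.log M₁ := by
    rw [← Real.log_rpow hr]; exact Real.log_le_log (Real.rpow_pos_of_pos hr _) hlow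
  have h2 : Real.log M₂ ≤ -C * Real.log r := by
    have := Real.log_le_log hM₂ hup; rwa [Real.log_rpow hr] at this
  have hε2 : 0 < 1 + 2 * ε := by linarith
  have h3 : (1 + 2 * ε) * Real.log M₁ ≤ (1 + ε) * Real.log Mq + ε * Real.log M₂ := by
    have := Real.log_le_log hM₁ hH
    rw [Real.log_mul (Real.rpow_pos_of_pos hMq _).ne' (Real.rpow_pos_of_pos hM₂ _).ne',
      Real.log_rpow hMq, Real.log_rpow hM₂] at this
    have e : (1 + 2 * ε) * ((1 + ε) / (1 + 2 * ε) * Real.log Mq + ε / (1 + 2 * ε) * Real.log M₂) =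
        (1 + ε) * Real.log Mq + ε * Real.log M₂ := by
      field_simp
    rw [← e]
    exact mul_le_mul_of_nonneg_left this hε2.le
  rw [Real.rpow_def_of_pos hMq, Real.rpow_def_of_pos hr, ← Real.exp_log hM₁, ← Real.exp_add,
    Real.exp_le_exp]
  have e1 : 0 ≤ ε * (Real.log M₁ - C * Real.log r) := mul_nonneg hε.le (sub_nonneg.2 h1)
  have e3 : ε * Real.log M₂ ≤ ε * (-C * Real.log r) := mul_le_mul_of_nonneg_left h2 hε.le
  nlinarith [e1, e3, h3]

/-! ## §2 Hölder toolkit -/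

/-- **Hölder's inequality** for non-negative functions given as integrability of the powers. -/
theorem holder_of_integrable_rpow {Ω : Type*} [MeasurableSpace Ω] {μ : Measure Ω} {p q : ℝ}
    (hpq : p.HolderConjugate q) {f g : Ω → ℝ} (hf0 : ∀ ω, 0 ≤ f ω) (hg0 : ∀ ω, 0 ≤ g ω)
    (hfm : AEStronglyMeasurable f μ) (hgm : AEStronglyMeasurable g μ)
    (hf : Integrable (fun ω ↦ f ω ^ p) μ) (hg : Integrable (fun ω ↦ g ω ^ q) μ) :
    ∫ ω, f ω * g ω ∂μ ≤ (∫ ω, f ω ^ p ∂μ) ^ (1 / p) * (∫ ω, g ω ^ q ∂μ) ^ (1 / q) := by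
  have hp : 0 < p := by linarith [(Real.holderConjugate_iff.1 hpq).1]
  have hq : 0 < q := by linarith [(Real.holderConjugate_iff.1 hpq.symm).1]
  refine integral_mul_le_Lp_mul_Lq_of_nonneg hpq (Eventually.of_forall hf0) (Eventually.of_forall hg0)
    ?_ ?_
  · refine (integrable_norm_rpow_iff hfm (ENNReal.ofReal_pos.2 hp).ne' ENNReal.ofReal_ne_top).1 ?_
    exact hf.congr (Eventually.of_forall fun ω ↦ by
      simp only [ENNReal.toReal_ofReal hp.le, Real.norm_of_nonneg (hf0 ω)])
  · refine (integrable_norm_rpow_iff hgm (ENNReal.ofReal_pos.2 hq).ne' ENNReal.ofReal_ne_top).1 ?_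
    exact hg.congr (Eventually.of_forall fun ω ↦ by
      simp only [ENNReal.toReal_ofReal hq.le, Real.norm_of_nonneg (hg0 ω)])

/-- For a non-negative base, real and natural powers commute: `(v^θ)^n = (v^n)^θ`. -/
theorem rpow_pow_comm' {v : ℝ} (hv : 0 ≤ v) (θ : ℝ) (n : ℕ) : (v ^ θ) ^ n = (v ^ n) ^ θ := by
  rw [← Real.rpow_natCast, ← Real.rpow_mul hv, mul_comm, Real.rpow_mul hv, Real.rpow_natCast]

end Hoelder

open Hoelder in
/-- **Interpolation of tower moments in the base** (Hölder): for `v₁, v₂ > 0`, `0 < θ < 1`,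
`E_δ[(v₁^θ v₂^{1−θ})^N] ≤ E_δ[v₁^N]^θ · E_δ[v₂^N]^{1−θ}` — log-convexity of `v ↦ log E[v^N]` in `log v`. -/
theorem towerMoment_interp : ∀ E ∈ latticeEnsembles, ∀ {δ : ℝ}, 0 < δ → ∀ (r : ℝ) {v₁ v₂ θ : ℝ},
    0 < v₁ → 0 < v₂ → 0 < θ → θ < 1 →
    E.towerMoment (v₁ ^ θ * v₂ ^ (1 - θ)) δ r ≤
      E.towerMoment v₁ δ r ^ θ * E.towerMoment v₂ δ r ^ (1 - θ) := by
  intro E hE δ hδ r v₁ v₂ θ hv₁ hv₂ hθ hθ1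
  have hθ' : 0 < 1 - θ := by linarith
  set N : E.Ω → ℕ := fun ω ↦ towerCount (E.X δ ω) 0 r 1 with hN
  have hmeas : Measurable N := measurable_towerCount E hE δ 0 r 1
  -- pointwise: the integrand is the product of the two rpow's
  have hpt : ∀ ω, (v₁ ^ θ * v₂ ^ (1 - θ)) ^ N ω = (v₁ ^ N ω) ^ θ * (v₂ ^ N ω) ^ (1 - θ) := by
    intro ω; rw [mul_pow, rpow_pow_comm' hv₁.le, rpow_pow_comm' hv₂.le]
  have hI1 := ConeTilt.integrable_pow_towerCount_of_nonneg E hE v₁ hδ 0 r 1 hv₁.le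
  have hI2 := ConeTilt.integrable_pow_towerCount_of_nonneg E hE v₂ hδ 0 r 1 hv₂.le
  have hH := holder_of_integrable_rpow (μ := E.P) (Real.HolderConjugate.inv_one_sub_inv hθ hθ1)
    (f := fun ω ↦ (v₁ ^ N ω) ^ θ) (g := fun ω ↦ (v₂ ^ N ω) ^ (1 - θ))
    (fun ω ↦ Real.rpow_nonneg (pow_nonneg hv₁.le _) _)
    (fun ω ↦ Real.rpow_nonneg (pow_nonneg hv₂.le _) _)
    ((hmeas.const_pow v₁).pow_const θ).aestronglyMeasurable
    ((hmeas.const_pow v₂).pow_const (1 - θ)).aestronglyMeasurable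
    (hI1.congr (Eventually.of_forall fun ω ↦ by
      simp only []; rw [← Real.rpow_mul (pow_nonneg hv₁.le _), mul_inv_cancel₀ hθ.ne', Real.rpow_one]))
    (hI2.congr (Eventually.of_forall fun ω ↦ by
      simp only []; rw [← Real.rpow_mul (pow_nonneg hv₂.le _), mul_inv_cancel₀ hθ'.ne', Real.rpow_one]))
  have e1 : ∫ ω, ((v₁ ^ N ω) ^ θ) ^ θ⁻¹ ∂E.P = E.towerMoment v₁ δ r := by
    refine integral_congr_ae (Eventually.of_forall fun ω ↦ ?_)
    simp only []; rw [← Real.rpow_mul (pow_nonneg hv₁.le _), mul_inv_cancel₀ hθ.ne', Real.rpow_one]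
  have e2 : ∫ ω, ((v₂ ^ N ω) ^ (1 - θ)) ^ (1 - θ)⁻¹ ∂E.P = E.towerMoment v₂ δ r := by
    refine integral_congr_ae (Eventually.of_forall fun ω ↦ ?_)
    simp only []; rw [← Real.rpow_mul (pow_nonneg hv₂.le _), mul_inv_cancel₀ hθ'.ne', Real.rpow_one]
  rw [e1, e2, one_div, inv_inv, one_div, inv_inv] at hH
  calc E.towerMoment (v₁ ^ θ * v₂ ^ (1 - θ)) δ r
      = ∫ ω, (v₁ ^ N ω) ^ θ * (v₂ ^ N ω) ^ (1 - θ) ∂E.P := by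
        rw [LoopEnsemble.towerMoment]; exact integral_congr_ae (Eventually.of_forall hpt)
    _ ≤ _ := hH

namespace Hoelder

/-- `x ↦ x^e` with `0 < e ≤ 1` does not increase a bound `≥ 1`: `0 ≤ D ≤ K`, `1 ≤ K` ⇒ `D^e ≤ K`. -/
theorem rpow_le_of_le_of_one_le {D K e : ℝ} (hD : 0 ≤ D) (hDK : D ≤ K) (hK : 1 ≤ K) (he : 0 ≤ e)
    (he1 : e ≤ 1) : D ^ e ≤ K := by
  calc D ^ e ≤ K ^ e := Real.rpow_le_rpow hD hDK he
    _ ≤ K ^ (1 : ℝ) := Real.rpow_le_rpow_of_exponent_le hK he1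
    _ = K := Real.rpow_one K

end Hoelder

end Summit.CriticalPhenomena.CardyFormulaZ2.Cruxes.NestingRigidity.PositiveConeWeightDoubling

end
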